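import Summits.CriticalPhenomena.PercolationContinuityZ3.Theorems.PercNearOneGluingNoHeavyLowerTailSahiInterpMoments
import Summits.CriticalPhenomena.PercolationContinuityZ3.Theorems.PercNearOneGluingNoHeavyLowerTailSahiInterpSubsetRec

/-!
# The interpolation leaf test for Sahi's `E_n` on `{0,1}^m`, VII: SOUNDNESS OF THE GRID DYNAMIC PROGRAMME

Support file (cell `prim-sahi`, seat `prim-sahi-typer` gen 30; `--supports stmt-CriticalPhenomena-4575`).  Pure proofs + one auxiliary definition
(`tval`, the target values `D^{|W|} · csW(bits W)`); standard axioms, no `sorry`.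

* **`zEntry_sound`** — one entry of …`SahiInterpCheck.zEntry` equals `tval W` provided the array it reads holds `tval` at the proper remainders:
  this is the block-peeling recursion …`SahiInterpSubsetRec.csW_rec` (Lieb–Sahi Prop. 3.4 along the cycle through the leading bit) in exact
  integer arithmetic (`subSum_eq`, the table lemmas of parts V–VI, `maskOf` algebra);
* **`zArr_sound`** — every entry `0 < S < k` of `zArr … k` is `tval S` (course-of-values induction);
* **`zVal_eq`** — `zVal m n d (encA ∘ A) x = d^{m n} · E_n(μ_{x/d}; 1_{A_0}, …, 1_{A_{n−1}})` (`0 < n`, `0 < d`; the top entry peels the highest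
  index, so only the `2^{n−1}` sub-families avoiding it are tabulated). [this work]
-/

namespace Summit.CriticalPhenomena.PercolationContinuityZ3.Theorems.SahiInterp

open Finset OneCutCert SahiC3Cube NCopyCert SahiSymCube

/-! ## Soundness of the dynamic programme -/

section DPSound

open Literature.Combinatorics.Sahi2008 (ex sahiE bernoulliWeight)
open Literature.Probability.Percolation.DecisionTree (ind)

variable {m n : ℕ}

/-- The target values of the DP: `D^{|W|} · csW(bits of W)`. [this work] -/
noncomputable def tval (μ : Set (Fin m) → ℝ) (F : Fin n → Set (Fin m) → ℝ) (D : ℝ) (W : ℕ) : ℝ :=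
  D ^ (bitsF n W).card * csW μ F (bitsF n W)

/-- Re-indexing the blocks through `v` by their remainders. [this work] -/
theorem sum_filter_mem_eq {α : Type*} [DecidableEq α] {W : Finset α} {v : α} (hv : v ∈ W) (Φ : Finset α → ℝ) :
    ∑ B ∈ W.powerset.filter (fun B => v ∈ B), Φ B = ∑ C ∈ (W.erase v).powerset, Φ (insert v C) := by
  refine Finset.sum_nbij' (fun B => B.erase v) (fun C => insert v C) ?_ ?_ ?_ ?_ ?_
  · intro B hB
    rw [Finset.mem_filter, Finset.mem_powerset] at hB
    rw [Finset.mem_powerset]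
    exact Finset.erase_subset_erase v hB.1
  · intro C hC
    rw [Finset.mem_powerset] at hC
    rw [Finset.mem_filter, Finset.mem_powerset]
    exact ⟨Finset.insert_subset hv (hC.trans (Finset.erase_subset v W)), Finset.mem_insert_self v C⟩
  · intro B hB
    rw [Finset.mem_filter] at hB
    exact Finset.insert_erase hB.2
  · intro C hC
    rw [Finset.mem_powerset] at hC
    exact Finset.erase_insert fun h => Finset.notMem_erase v W (hC h)
  · intro B hB
    rw [Finset.mem_filter] at hB
    rw [Finset.insert_erase hB.2]

/-- The single-position mask. [this work] -/
theorem maskOf_singleton (v : Fin n) : maskOf ({v} : Finset (Fin n)) = 2 ^ (v : ℕ) := by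
  rw [← Finset.insert_empty, maskOf_insert, maskOf_eq_zero_iff.2 rfl, Nat.zero_or]

/-- **One DP entry is correct given the entries it reads.**  For `W < 2^n` with a set bit `v` in front of its bit list, if `z` holds
`tval` at the masks of the nonempty... proper remainders `R ∖ C` (`R` = bits of `W` without `v`, `C ⊊ R`), then `zEntry … z W = tval W`
(the block-peeling recursion …`SahiInterpSubsetRec.csW_rec` in integer arithmetic). [this work] -/
theorem zEntry_sound {d : ℕ} (hd : 0 < d) (A : Fin n → Set (Set (Fin m))) (x : Fin m → ℕ) (hx : ∀ i, x i ≤ d)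
    {W : ℕ} (hW : W < 2 ^ n) {v : Fin n} {rest : List (Fin n)} (hb : bitsD n W = v :: rest) (z : Array ℤ)
    (hz : ∀ C, C ⊆ (bitsF n W).erase v → C ≠ (bitsF n W).erase v →
      ((z.getD (maskOf (((bitsF n W).erase v) \ C)) 0 : ℤ) : ℝ) =
        tval (bernoulliWeight (gridP d x hx)) (fun i => ind (A i)) ((d : ℝ) ^ m) (maskOf (((bitsF n W).erase v) \ C))) :
    ((zEntry n (coefTab n ((d : ℤ) ^ m)) (pcTab n) (momTab n (ptsTab m n (maskTab m n (List.ofFn fun i => encA m (A i)))) (atomTab m d x))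
        z W : ℤ) : ℝ) = tval (bernoulliWeight (gridP d x hx)) (fun i => ind (A i)) ((d : ℝ) ^ m) W := by
  classical
  obtain ⟨hvW, hnd, -, hrest⟩ := bitsD_cons hb
  set μ := bernoulliWeight (gridP d x hx) with hμ
  set F : Fin n → Set (Fin m) → ℝ := fun i => ind (A i) with hF
  set D : ℝ := (d : ℝ) ^ m with hD
  set Wf := bitsF n W with hWf
  set R := Wf.erase v with hR
  set momT := momTab n (ptsTab m n (maskTab m n (List.ofFn fun i => encA m (A i)))) (atomTab m d x) with hmomT
  have hvWf : v ∈ Wf := mem_bitsF.2 hvW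
  have hRW : R ⊆ Wf := Finset.erase_subset v Wf
  have hW' : W ^^^ 2 ^ (v : ℕ) = maskOf R := by
    rw [hR, ← Finset.sdiff_singleton_eq_erase, maskOf_sdiff (Finset.singleton_subset_iff.2 hvWf), hWf, maskOf_bitsF hW,
      maskOf_singleton]
  have hcardW : Wf.card = R.card + 1 := by rw [hR, Finset.card_erase_of_mem hvWf]; have := Finset.card_pos.2 ⟨v, hvWf⟩; omega
  have hlen : rest.length = R.card := by
    rw [← List.toFinset_card_of_nodup hnd, hrest]
  -- table lookups
  have hcoef : ∀ k, k ≤ n → (((coefTab n ((d : ℤ) ^ m)).getD k 0 : ℤ) : ℝ) = (k.factorial : ℝ) * D ^ k := by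
    intro k hk; rw [coefTab_getD _ hk]; push_cast; rw [hD]
  have hpc : ∀ C : Finset (Fin n), (pcTab n).getD (maskOf C) 0 = C.card := by
    intro C; rw [pcTab_getD (maskOf_lt C), bitsF_maskOf]
  have hmom : ∀ C : Finset (Fin n), ((momT.getD (maskOf C) 0 : ℤ) : ℝ) = D * ex μ (fun ω => ∏ j ∈ C, F j ω) := by
    intro C; rw [hmomT, momTab_eq_ex hd A x hx (maskOf_lt C), bitsF_maskOf]
  have hmomW : ((momT.getD W 0 : ℤ) : ℝ) = D * ex μ (fun ω => ∏ j ∈ Wf, F j ω) := by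
    rw [hmomT, momTab_eq_ex hd A x hx hW]
  have hcardC : ∀ C, C ⊆ R → C.card ≤ n := fun C _ => (Finset.card_le_univ C).trans (by rw [Fintype.card_fin])
  -- the entry, unfolded
  have hentry : zEntry n (coefTab n ((d : ℤ) ^ m)) (pcTab n) momT z W =
      (coefTab n ((d : ℤ) ^ m)).getD rest.length 0 * momT.getD W 0 -
        subSum (fun S => if S = W ^^^ 2 ^ (v : ℕ) then 0 else
          (coefTab n ((d : ℤ) ^ m)).getD ((pcTab n).getD S 0) 0 * momT.getD (S ||| 2 ^ (v : ℕ)) 0 *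
            z.getD ((W ^^^ 2 ^ (v : ℕ)) ^^^ S) 0) rest 0 := by
    unfold zEntry; rw [hb]
  rw [hentry, subSum_eq _ rest hnd 0, hrest]
  push_cast
  simp only [Nat.zero_or]
  -- the summands
  have hsummand : ∀ C ∈ R.powerset,
      (if maskOf C = W ^^^ 2 ^ (v : ℕ) then (0 : ℝ) else
          (((coefTab n ((d : ℤ) ^ m)).getD ((pcTab n).getD (maskOf C) 0) 0 : ℤ) : ℝ) * ((momT.getD (maskOf C ||| 2 ^ (v : ℕ)) 0 : ℤ) : ℝ) *
            ((z.getD ((W ^^^ 2 ^ (v : ℕ)) ^^^ maskOf C) 0 : ℤ) : ℝ)) =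
        if C = R then 0 else
          (C.card.factorial : ℝ) * D ^ Wf.card * ex μ (fun ω => ∏ j ∈ insert v C, F j ω) * csW μ F (R \ C) := by
    intro C hC
    rw [Finset.mem_powerset] at hC
    by_cases hCR : C = R
    · rw [if_pos (by rw [hCR, hW']), if_pos hCR]
    · have hne : maskOf C ≠ W ^^^ 2 ^ (v : ℕ) := by rw [hW']; exact fun h => hCR (maskOf_injective h)
      rw [if_neg hne, if_neg hCR]
      rw [hpc C, hcoef _ (hcardC C hC), ← maskOf_insert, hmom (insert v C), hW', ← maskOf_sdiff hC, hz C hC hCR, tval,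
        bitsF_maskOf, Finset.card_sdiff_of_subset hC, hcardW]
      have hle : C.card ≤ R.card := Finset.card_le_card hC
      have hpow : D ^ C.card * D * D ^ (R.card - C.card) = D ^ (R.card + 1) := by
        rw [← pow_succ, ← pow_add]; congr 1; omega
      calc (C.card.factorial : ℝ) * D ^ C.card * (D * ex μ (fun ω => ∏ j ∈ insert v C, F j ω)) *
            (D ^ (R.card - C.card) * csW μ F (R \ C))
          = (C.card.factorial : ℝ) * (D ^ C.card * D * D ^ (R.card - C.card)) * ex μ (fun ω => ∏ j ∈ insert v C, F j ω) *
              csW μ F (R \ C) := by ring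
        _ = _ := by rw [hpow]
  rw [Finset.sum_congr rfl hsummand]
  -- the target
  rw [tval, ← hWf, csW_rec μ F hvWf, sum_filter_mem_eq hvWf, ← hR, Finset.mul_sum]
  have htarget : ∀ C ∈ R.powerset,
      D ^ Wf.card * ((((insert v C).card - 1).factorial : ℝ) *
        (ex μ (fun ω => ∏ j ∈ insert v C, F j ω) * (if insert v C = Wf then 1 else -csW μ F (Wf \ insert v C)))) =
      (if C = R then (R.card.factorial : ℝ) * D ^ Wf.card * ex μ (fun ω => ∏ j ∈ Wf, F j ω) else 0) -
        (if C = R then 0 else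
          (C.card.factorial : ℝ) * D ^ Wf.card * ex μ (fun ω => ∏ j ∈ insert v C, F j ω) * csW μ F (R \ C)) := by
    intro C hC
    rw [Finset.mem_powerset] at hC
    have hvC : v ∉ C := fun hvC => Finset.notMem_erase v Wf (hC hvC)
    rw [Finset.card_insert_of_notMem hvC, Nat.add_sub_cancel]
    by_cases hCR : C = R
    · have hins : insert v C = Wf := by rw [hCR, hR, Finset.insert_erase hvWf]
      rw [if_pos hins, if_pos hCR, if_pos hCR, hins, hCR]; ring
    · have hins : insert v C ≠ Wf := by
        intro h; apply hCR; rw [hR, ← h, Finset.erase_insert hvC]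
      have hsd : Wf \ insert v C = R \ C := by
        ext j
        simp only [Finset.mem_sdiff, Finset.mem_insert, hR, Finset.mem_erase, not_or]
        tauto
      rw [if_neg hins, if_neg hCR, if_neg hCR, hsd]; ring
  rw [Finset.sum_congr rfl htarget, Finset.sum_sub_distrib, Finset.sum_ite_eq' R.powerset R, if_pos (Finset.mem_powerset.2 le_rfl),
    hlen, hcoef _ ((hcardC R le_rfl)), hmomW, hcardW]
  ring

/-- Masks of subsets of positions below `k` are `< 2^k`. [this work] -/
theorem maskOf_lt_two_pow {C : Finset (Fin n)} {k : ℕ} (h : ∀ j ∈ C, (j : ℕ) < k) : maskOf C < 2 ^ k := by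
  refine Nat.lt_pow_two_of_testBit _ fun t ht => ?_
  rw [testBit_maskOf]
  exact decide_eq_false fun ⟨j, hj, hjt⟩ => by have := h j hj; omega

/-- **All entries of the DP array are correct**: `(zArr … k)[S] = tval S` for `0 < S < k`, `S < 2^n`. [this work] -/
theorem zArr_sound {d : ℕ} (hd : 0 < d) (A : Fin n → Set (Set (Fin m))) (x : Fin m → ℕ) (hx : ∀ i, x i ≤ d) :
    ∀ (k : ℕ) (S : ℕ), S < k → S ≠ 0 → S < 2 ^ n →
      (((zArr n (coefTab n ((d : ℤ) ^ m)) (pcTab n)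
          (momTab n (ptsTab m n (maskTab m n (List.ofFn fun i => encA m (A i)))) (atomTab m d x)) k).getD S 0 : ℤ) : ℝ) =
        tval (bernoulliWeight (gridP d x hx)) (fun i => ind (A i)) ((d : ℝ) ^ m) S
  | 0, S, hS, _, _ => absurd hS (Nat.not_lt_zero S)
  | k + 1, S, hS, hS0, hSn => by
    have hsize : ∀ j, (zArr n (coefTab n ((d : ℤ) ^ m)) (pcTab n)
        (momTab n (ptsTab m n (maskTab m n (List.ofFn fun i => encA m (A i)))) (atomTab m d x)) j).size = j := by
      intro j; induction j with
      | zero => rfl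
      | succ j ih => rw [zArr, Array.size_push, ih]
    rw [zArr, Array.getD_eq_getD_getElem?, Array.getElem?_push, hsize k]
    by_cases hSk : S = k
    · rw [if_pos hSk, Option.getD_some, hSk]
      have hkn : k < 2 ^ n := hSk ▸ hSn
      have hk0 : k ≠ 0 := hSk ▸ hS0
      -- the new entry
      obtain ⟨v, rest, hb⟩ : ∃ v rest, bitsD n k = v :: rest := by
        cases h : bitsD n k with
        | nil => exact absurd h (bitsD_ne_nil hkn hk0)
        | cons v rest => exact ⟨v, rest, rfl⟩
      refine zEntry_sound hd A x hx hkn hb _ fun C hC hCR => ?_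
      obtain ⟨hvS, -, -, -⟩ := bitsD_cons hb
      have hvWf : v ∈ bitsF n k := mem_bitsF.2 hvS
      set R := (bitsF n k).erase v with hR
      have hRmask : maskOf R = k ^^^ 2 ^ (v : ℕ) := by
        rw [hR, ← Finset.sdiff_singleton_eq_erase, maskOf_sdiff (Finset.singleton_subset_iff.2 hvWf), maskOf_bitsF hkn,
          maskOf_singleton]
      have hRlt : maskOf R < k := by
        have hle : maskOf R ≤ k := by
          have h1 := maskOf_and_of_subset (Finset.erase_subset v (bitsF n k))
          rw [maskOf_bitsF hkn] at h1
          rw [← h1]; exact Nat.and_le_right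
        have hne : maskOf R ≠ k := by
          intro h
          have := congrArg (fun M => Nat.testBit M v) h
          simp only [hRmask, Nat.testBit_xor, hvS, Nat.testBit_two_pow_self] at this
          exact Bool.noConfusion this
        omega
      have hDlt : maskOf (R \ C) < k := by
        have h1 := maskOf_and_of_subset (Finset.sdiff_subset (s := R) (t := C))
        have : maskOf (R \ C) ≤ maskOf R := by rw [← h1]; exact Nat.and_le_right
        omega
      have hD0 : maskOf (R \ C) ≠ 0 := by
        rw [Ne, maskOf_eq_zero_iff, Finset.sdiff_eq_empty_iff_subset]
        exact fun h => hCR (Finset.Subset.antisymm hC h)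
      have := zArr_sound hd A x hx k (maskOf (R \ C)) hDlt hD0 (maskOf_lt _)
      rw [Array.getD_eq_getD_getElem?] at this
      rw [Array.getD_eq_getD_getElem?]
      exact this
    · rw [if_neg hSk]
      have hSk' : S < k := by omega
      have := zArr_sound hd A x hx k S hSk' hS0 hSn
      rw [Array.getD_eq_getD_getElem?] at this
      exact this

/-- The bit list of the full mask starts with the top position. [this work] -/
theorem bitsD_full (k : ℕ) : ∃ rest, bitsD (k + 1) (2 ^ (k + 1) - 1) = Fin.last k :: rest := by
  unfold bitsD
  have hall : ((List.finRange (k + 1)).filter fun j : Fin (k + 1) => (2 ^ (k + 1) - 1).testBit (j : ℕ)) = List.finRange (k + 1) := by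
    rw [List.filter_eq_self]
    intro j _
    rw [Nat.testBit_two_pow_sub_one]
    exact decide_eq_true j.isLt
  rw [hall, List.finRange_succ_last, List.reverse_append, List.reverse_singleton, List.singleton_append]
  exact ⟨_, rfl⟩

/-- **`zVal m n d a x = d^{m n} · E_n(μ_{x/d}; A)`** for `0 < n`, `0 < d`. [this work] -/
theorem zVal_eq {d : ℕ} (hd : 0 < d) (hn : 0 < n) (A : Fin n → Set (Set (Fin m))) (x : Fin m → ℕ) (hx : ∀ i, x i ≤ d) :
    ((zVal m n d (fun i => encA m (A i)) x : ℤ) : ℝ) =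
      ((d : ℝ) ^ m) ^ n * sahiE (bernoulliWeight (gridP d x hx)) n (fun i => ind (A i)) := by
  obtain ⟨k, rfl⟩ : ∃ k, n = k + 1 := ⟨n - 1, by omega⟩
  have hfull : 2 ^ (k + 1) - 1 < 2 ^ (k + 1) := Nat.sub_lt (Nat.two_pow_pos _) Nat.one_pos
  have hbits : bitsF (k + 1) (2 ^ (k + 1) - 1) = Finset.univ := by
    ext j; rw [mem_bitsF, Nat.testBit_two_pow_sub_one]; simp [j.isLt]
  obtain ⟨rest, hb⟩ := bitsD_full k
  unfold zVal zTop
  rw [zEntry_sound hd A x hx hfull hb]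
  · rw [tval, hbits, Finset.card_univ, Fintype.card_fin, csW_univ _ (Nat.succ_pos k)]
  · intro C hC hCR
    rw [hbits] at hC hCR ⊢
    have hlt : maskOf (Finset.univ.erase (Fin.last k) \ C) < 2 ^ (k + 1 - 1) := by
      rw [Nat.add_sub_cancel]
      refine maskOf_lt_two_pow fun j hj => ?_
      have hj' := (Finset.mem_sdiff.1 hj).1
      rw [Finset.mem_erase] at hj'
      exact lt_of_le_of_ne (Nat.lt_succ_iff.1 j.isLt) fun h => hj'.1 (Fin.ext (by rw [h, Fin.val_last]))
    have h0 : maskOf (Finset.univ.erase (Fin.last k) \ C) ≠ 0 := by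
      rw [Ne, maskOf_eq_zero_iff, Finset.sdiff_eq_empty_iff_subset]
      exact fun h => hCR (Finset.Subset.antisymm hC h)
    exact zArr_sound hd A x hx _ _ hlt h0 (maskOf_lt _)

end DPSound

end Summit.CriticalPhenomena.PercolationContinuityZ3.Theorems.SahiInterp
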